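import Mathlib
import Literature.Computability.AlgebraicComplexity.PermanentIrreducible
import Literature.Computability.AlgebraicComplexity.StandardFamiliesProofs
import Summits.ValiantsHypothesis.ValiantsHypothesis.Theorems.DivisionGapPerCofactorDegreeReductionStubTwoTowerCollapse
import Summits.ValiantsHypothesis.ValiantsHypothesis.Theorems.PermHypersurfaceFactorial.Negative.CharTwoKernelPrime

/-!
# Crux `DivisionGap.PerCofactorDegreeReduction` (stmt-ValiantsHypothesis-15046), line `Sketch` —
# stub `stub_algebraicIsConstant`: `ℝ` is algebraically closed in `ℝ[x]/(per_n)`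

**Theorem (`stub_algebraicIsConstant`).** Let `n ≥ 1`, `F ∈ ℝ[x_ij]` (`n × n` variables) and let
`p ∈ ℝ[T]` be nonzero with `per_n ∣ p(F)` over `ℝ`.  Then `per_n ∣ F - c` over `ℝ` for some REAL
root `c` of `p`: a class of `ℝ[x]/(per_n)` that is algebraic over `ℝ` is a real constant (the
constants principle behind the collapse of binary-form relations modulo the permanent).

## Proof

Complexify.  `per_n` is irreducible over any integral domain (`perPoly_irreducible`), hence prime
in the UFD `K[x]` for every field `K` (tree theorem
`PermHypersurfaceFactorial.Negative.CharTwo.perPoly_prime`).  Over `ℂ` the polynomial `p` splits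
(`IsAlgClosed.splits`, `Polynomial.Splits.eq_prod_roots`): `p = lead(p) · ∏_{λ ∈ roots p} (T - λ)`,
so `p(G) = lead(p) · ∏ (G - λ)` for every `G ∈ ℂ[x]`, and a prime divisor of `p(G)` divides some
`G - λ` since `lead(p) ≠ 0` is a unit (`Prime.exists_mem_multiset_map_dvd`;
`exists_root_dvd_sub_C`).  Apply this to `G = F_ℂ`: `per_n ∣ p(F)` over `ℝ` gives
`per_n ∣ (p(F))_ℂ = p_ℂ(F_ℂ)` over `ℂ` (`TwoTowerCollapse.per_ascent`,
`Polynomial.map_aeval_eq_aeval_map`), so `per_n ∣ F_ℂ - λ` for a complex root `λ` of `p`.  If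
`λ ∉ ℝ`, the imaginary part of the cofactor exhibits `per_n ∣ 1` over `ℝ`
(`TwoTowerCollapse.dvd_of_map_dvd_sub_C_mul` with `r' = 1`), absurd as `per_n` is not a unit.  So
`λ = c ∈ ℝ`, `p(c) = 0` (`Polynomial.IsRoot.of_map`, `ℝ ↪ ℂ`), and `per_n ∣ F - c` over `ℝ` by
descent of divisibility (`TwoTowerCollapse.per_descent`, real parts of the cofactor).

Leans on the tree only: `PermHypersurfaceFactorial.Negative.CharTwo.perPoly_prime` (from
`perPoly_irreducible`), `map_perPoly`,
`TwoTowerCollapse.{per_descent, per_ascent, dvd_of_map_dvd_sub_C_mul}`; Mathlib.  No definitions.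
-/

noncomputable section

-- `Summit.ValiantsHypothesis.ValiantsHypothesis.…` is the tree's mandated single-conjunct layout
-- (Problem = Summit), so the duplicated namespace component is intended.
set_option linter.dupNamespace false

namespace Summit.ValiantsHypothesis.ValiantsHypothesis.Theorems.DivisionGap.PerCofactorDegreeReduction.AlgebraicIsConstant

open MvPolynomial Literature.Computability.AlgebraicComplexity
open Summit.ValiantsHypothesis.ValiantsHypothesis.Theorems.DivisionGap.PerCofactorDegreeReduction.TwoTowerCollapse
  (per_descent per_ascent dvd_of_map_dvd_sub_C_mul)
open Summit.ValiantsHypothesis.Theorems.PermHypersurfaceFactorial.Negative.CharTwo (perPoly_prime)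

/-! ### Prime divisors of `p(G)` over an algebraically closed field -/

/-- **A prime divisor of `p(G)` divides a linear factor.** Over an algebraically closed field `K`,
if a prime `P ∈ K[x]` divides `p(G)` for a nonzero `p ∈ K[T]` and `G ∈ K[x]`, then `P ∣ G - λ` for
some root `λ` of `p`: `p(G) = lead(p) · ∏_{λ ∈ roots p} (G - λ)` and `lead(p) ≠ 0` is a unit.
[folklore] -/
theorem exists_root_dvd_sub_C {K : Type*} [Field K] [IsAlgClosed K] {σ : Type*}
    {P G : MvPolynomial σ K} (hP : Prime P) {p : Polynomial K} (hp : p ≠ 0)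
    (h : P ∣ Polynomial.aeval G p) : ∃ a ∈ p.roots, P ∣ G - C a := by
  have hsplit := (IsAlgClosed.splits p).eq_prod_roots
  rw [hsplit, map_mul, Polynomial.aeval_C, map_multiset_prod, Multiset.map_map] at h
  have hunit : IsUnit (algebraMap K (MvPolynomial σ K) p.leadingCoeff) :=
    (isUnit_iff_ne_zero.mpr (Polynomial.leadingCoeff_ne_zero.mpr hp)).map _
  have h' := (hP.dvd_or_dvd h).resolve_left fun hd => hP.not_unit (isUnit_of_dvd_unit hd hunit)
  obtain ⟨a, ha, hPa⟩ := hP.exists_mem_multiset_map_dvd h'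
  exact ⟨a, ha, by simpa using hPa⟩

/-! ### Complexification of `p(F)` -/

/-- Complexification commutes with the evaluation of a one-variable real polynomial at a
multivariate real polynomial: `(p(F))_ℂ = p_ℂ(F_ℂ)`. [folklore] -/
theorem map_ofRealHom_aeval {σ : Type*} (F : MvPolynomial σ ℝ) (p : Polynomial ℝ) :
    map Complex.ofRealHom (Polynomial.aeval F p) =
      Polynomial.aeval (map Complex.ofRealHom F) (p.map Complex.ofRealHom) :=
  Polynomial.map_aeval_eq_aeval_map (RingHom.ext fun r => by simp) p F

/-! ### The theorem -/

/-- **stub_algebraicIsConstant — `ℝ` is algebraically closed in `ℝ[x]/(per_n)`.**  For `n ≥ 1`,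
`F ∈ ℝ[x_ij]` and a nonzero `p ∈ ℝ[T]` with `per_n ∣ p(F)` over `ℝ`, there is a real root `c` of
`p` with `per_n ∣ F - c` over `ℝ`.  Proof: over `ℂ`, `p(F) = lead(p) · ∏ (F - λ)` over the complex
roots `λ` of `p` and `per_n` is prime, so `per_n ∣ F - λ` for some root `λ`; `λ` is real (else
the imaginary part of the cofactor gives `per_n ∣ 1`), `p(λ) = 0`, and the divisibility descends
to `ℝ` (real part of the cofactor). [folklore] -/
theorem stub_algebraicIsConstant (n : ℕ) (hn : 1 ≤ n) (F : MvPolynomial (Fin n × Fin n) ℝ)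
    (p : Polynomial ℝ) (hp : p ≠ 0)
    (h : perPoly (Fin n) ℝ ∣ Polynomial.aeval F p) :
    ∃ c : ℝ, p.IsRoot c ∧ perPoly (Fin n) ℝ ∣ F - C c := by
  -- complexify: `per_n ∣ p_ℂ(F_ℂ)` over `ℂ`
  have hC : perPoly (Fin n) ℂ ∣
      Polynomial.aeval (map Complex.ofRealHom F) (p.map Complex.ofRealHom) := by
    rw [← map_ofRealHom_aeval]
    exact per_ascent h
  -- a complex root `a` of `p` with `per_n ∣ F_ℂ - a` over `ℂ`
  obtain ⟨a, ha, hdvd⟩ :=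
    exists_root_dvd_sub_C (perPoly_prime ℂ hn) (Polynomial.map_ne_zero hp) hC
  -- `a` is real: otherwise the imaginary part of the cofactor gives `per_n ∣ 1` over `ℝ`
  have him : a.im = 0 := by
    by_contra him
    refine (perPoly_prime ℝ hn).not_unit (isUnit_of_dvd_one ?_)
    refine dvd_of_map_dvd_sub_C_mul (r := F) him ?_
    rwa [map_perPoly, map_one, mul_one]
  have hac : a = ((a.re : ℝ) : ℂ) := Complex.ext (by simp) (by simp [him])
  refine ⟨a.re, ?_, per_descent ?_⟩
  · -- `p(re a) = 0`, from `p_ℂ(a) = 0` and the injectivity of `ℝ → ℂ`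
    have hroot : (p.map Complex.ofRealHom).IsRoot (Complex.ofRealHom a.re) := by
      rw [Complex.ofRealHom_eq_coe, ← hac]
      exact Polynomial.isRoot_of_mem_roots ha
    exact hroot.of_map Complex.ofRealHom.injective
  · -- `per_n ∣ (F - re a)_ℂ = F_ℂ - a` over `ℂ`
    rwa [map_sub, map_C, Complex.ofRealHom_eq_coe, ← hac]

end Summit.ValiantsHypothesis.ValiantsHypothesis.Theorems.DivisionGap.PerCofactorDegreeReduction.AlgebraicIsConstant

end
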